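import Mathlib
import Summits.NavierStokesRegularity.NavierStokesRegularity.Theorems.FilamentSkeletonRssSkeletonJ1RLineDefs
import Summits.NavierStokesRegularity.NavierStokesRegularity.Theorems.FilamentSkeletonRssSkeletonJ1RLiaDefectDerivResidualForm
import Summits.NavierStokesRegularity.NavierStokesRegularity.Theorems.FilamentSkeletonRssSkeletonJ1RLiaResidualBound
import Summits.NavierStokesRegularity.NavierStokesRegularity.Theorems.FilamentSkeletonRssSkeletonJ1RLiaCollarCurvature

/-!
# Crux `SkeletonJ1R` (stmt-NavierStokesRegularity-23610) · line `streamline_kantorovich_R` · stub F2-d (`LiaDefectDerivBL`, v7):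
# REDUCTION OF THE STUB TO ONE ANALYTIC ESTIMATE — the collar bound of the NORMAL PART OF THE RESIDUAL'S DERIVATIVE

Lead `ns-fsr-lead-23610` g2, `--supports stmt-NavierStokesRegularity-23610 --as helper`.  MODEL rung, NEGATIVE side of the ladder: estimates for a
HYPOTHETICAL filament-type blow-up skeleton; nothing here is a claim about Navier–Stokes regularity; the stub and the crux stay OPEN.

`liaDefectDerivBL_of_perpResidualDeriv_bound` — `LiaDefectDerivBL` FOLLOWS from the single estimate (hypothesis `h`, stated with the quantifier prefix of
`LiaDefectBL`): at every INTERIOR collar point `ℓ² ≤ ‖x_j τ‖² < 2ℓ²`, `ℓ·‖R′ − ⟪R′, x_j′τ⟫ x_j′τ‖ ≤ C (√Γ + |τ|)/√(log Γ)`, where `R′` is the explicit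
derivative of the strand residual along the reference (`…LiaDefectDerivResidualForm.IsLiaReference.hasDerivAt_residual`).  Everything else is in the
tree: the residual form of `D′` (interior points) and `D′ = 0` at the edge (`…ResidualForm`), the `σ′`-term and the `⟪R,P′⟫P`, `⟪R,P⟩P′` terms via
the RATE-B residual bound (`…LiaResidualBound.liaResidual_bound`) and the Γ-uniform collar curvature `ℓ‖x_j″‖ ≤ K` (`…LiaCollarCurvature`).
What remains of F2-d is therefore exactly `h`: the zone bookkeeping of `R′` (B1/B2 of the F2-B chain with the derivative kernels).
-/

set_option linter.dupNamespace false -- `NavierStokesRegularity.NavierStokesRegularity` path/namespace repetition is the tree convention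

noncomputable section

namespace Summit.NavierStokesRegularity.NavierStokesRegularity.Theorems.SkeletonJ1RFrame

open Set Function Filter Real Topology MeasureTheory
open Literature.Analysis.FluidPDE
open Summit.NavierStokesRegularity.NavierStokesRegularity.Theorems.FilamentSkeletonRssSkeletonJ1GSplit (NearStraightJ1G StraightDatum)
open scoped InnerProductSpace BigOperators

/-! ## §1 A norm inequality for the residual form -/

/-- The residual form is bounded by its three kinds of terms (`‖P‖ = 1`, `0 ≤ σ₀ ≤ 1`). [folklore] -/
theorem norm_residualForm_le {σ' σ₀ : ℝ} {R R' P P' : EuclideanSpace ℝ (Fin 3)} (hP : ‖P‖ = 1) (hσ₀ : 0 ≤ σ₀) (hσ₁ : σ₀ ≤ 1) :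
    ‖σ' • (R - ⟪R, P⟫_ℝ • P) + σ₀ • (R' - ⟪R', P⟫_ℝ • P - ⟪R, P'⟫_ℝ • P - ⟪R, P⟫_ℝ • P')‖ ≤
      ‖σ' • (R - ⟪R, P⟫_ℝ • P)‖ + ‖R' - ⟪R', P⟫_ℝ • P‖ + 2 * (‖R‖ * ‖P'‖) := by
  have h1 : ‖⟪R, P'⟫_ℝ • P‖ ≤ ‖R‖ * ‖P'‖ := by
    rw [norm_smul, Real.norm_eq_abs, hP, mul_one]; exact abs_real_inner_le_norm R P'
  have h2 : ‖⟪R, P⟫_ℝ • P'‖ ≤ ‖R‖ * ‖P'‖ := by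
    rw [norm_smul, Real.norm_eq_abs]
    have := abs_real_inner_le_norm R P
    rw [hP, mul_one] at this
    exact mul_le_mul_of_nonneg_right this (norm_nonneg _)
  have h3 : ‖R' - ⟪R', P⟫_ℝ • P - ⟪R, P'⟫_ℝ • P - ⟪R, P⟫_ℝ • P'‖ ≤ ‖R' - ⟪R', P⟫_ℝ • P‖ + 2 * (‖R‖ * ‖P'‖) := by
    calc ‖R' - ⟪R', P⟫_ℝ • P - ⟪R, P'⟫_ℝ • P - ⟪R, P⟫_ℝ • P'‖
        ≤ ‖R' - ⟪R', P⟫_ℝ • P - ⟪R, P'⟫_ℝ • P‖ + ‖⟪R, P⟫_ℝ • P'‖ := norm_sub_le _ _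
      _ ≤ (‖R' - ⟪R', P⟫_ℝ • P‖ + ‖⟪R, P'⟫_ℝ • P‖) + ‖⟪R, P⟫_ℝ • P'‖ := by gcongr; exact norm_sub_le _ _
      _ ≤ ‖R' - ⟪R', P⟫_ℝ • P‖ + 2 * (‖R‖ * ‖P'‖) := by linarith
  have h4 : ‖σ₀ • (R' - ⟪R', P⟫_ℝ • P - ⟪R, P'⟫_ℝ • P - ⟪R, P⟫_ℝ • P')‖ ≤ ‖R' - ⟪R', P⟫_ℝ • P‖ + 2 * (‖R‖ * ‖P'‖) := by
    rw [norm_smul, Real.norm_eq_abs, abs_of_nonneg hσ₀]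
    calc σ₀ * ‖R' - ⟪R', P⟫_ℝ • P - ⟪R, P'⟫_ℝ • P - ⟪R, P⟫_ℝ • P'‖ ≤ 1 * ‖R' - ⟪R', P⟫_ℝ • P - ⟪R, P'⟫_ℝ • P - ⟪R, P⟫_ℝ • P'‖ :=
          mul_le_mul_of_nonneg_right hσ₁ (norm_nonneg _)
      _ ≤ _ := by rw [one_mul]; exact h3
  calc _ ≤ ‖σ' • (R - ⟪R, P⟫_ℝ • P)‖ + ‖σ₀ • (R' - ⟪R', P⟫_ℝ • P - ⟪R, P'⟫_ℝ • P - ⟪R, P⟫_ℝ • P')‖ := norm_add_le _ _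
    _ ≤ _ := by linarith

/-! ## §2 The reduction -/

set_option maxHeartbeats 1600000 in
/-- **`LiaDefectDerivBL` FOLLOWS FROM THE COLLAR BOUND OF THE NORMAL PART OF THE RESIDUAL'S DERIVATIVE** (see the module docstring). [folklore] -/
theorem liaDefectDerivBL_of_perpResidualDeriv_bound
    (h : ∀ (N : ℕ) (δd ρd Λd Rwd θd mw : ℝ) (p t : Fin N → EuclideanSpace ℝ (Fin 3)) (γ : Fin N → ℝ) (α : ℝ) (s₀ : Fin N → ℝ),
      0 < N → 0 < δd → 0 < ρd → 0 < Rwd → 0 < θd → 0 < mw → StraightDatum N δd ρd Λd Rwd θd mw p t γ α s₀ →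
      (∀ j k, j ≠ k → |⟪t j, t k⟫_ℝ| ≤ 1 - θd) →
      ∃ Rb₁ : ℝ, 0 < Rb₁ ∧ ∀ Rb : ℝ, 0 < Rb → Rb ≤ Rb₁ → ∃ (Γ₁ Ch : ℝ), ∀ Γ : ℝ, Γ₁ ≤ Γ →
        ∀ (x : Fin N → ℝ → EuclideanSpace ℝ (Fin 3)) (M : EuclideanSpace ℝ (Fin 3) → EuclideanSpace ℝ (Fin 3)),
          IsLiaReference Γ Rb p t γ α s₀ x → SlicedFrame Γ ρd 1 Rb p t s₀ x M →
          ∀ j τ, (Rb * Real.sqrt (Γ * Real.log Γ)) ^ 2 ≤ ‖x j τ‖ ^ 2 → ‖x j τ‖ ^ 2 < 2 * (Rb * Real.sqrt (Γ * Real.log Γ)) ^ 2 →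
          ∀ R' : EuclideanSpace ℝ (Fin 3),
            HasDerivAt (fun τ' => ((Γ * γ j / (4 * Real.pi)) • (∫ σ : ℝ, ((‖x j τ' - x j σ‖ ^ 2 +
                Real.exp (-(1+Real.eulerMascheroniConstant-Real.log 2)) * (1:ℝ)) ^ (3 / 2 : ℝ))⁻¹ • cross (deriv (x j) σ) (x j τ' - x j σ)) -
              liaCoeff Γ γ j • cross (deriv (x j) τ') (deriv (deriv (x j)) τ')) +
              ∑ k ∈ Finset.univ.erase j, (Γ * γ k / (4 * Real.pi)) • ((∫ σ : ℝ, ((‖x j τ' - x k σ‖ ^ 2 +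
                Real.exp (-(1+Real.eulerMascheroniConstant-Real.log 2)) * (1:ℝ)) ^ (3 / 2 : ℝ))⁻¹ • cross (deriv (x k) σ) (x j τ' - x k σ)) -
              ∫ σ : ℝ, ((‖x j τ' - datumLine Γ p t s₀ k σ‖ ^ 2 +
                Real.exp (-(1+Real.eulerMascheroniConstant-Real.log 2)) * (1:ℝ)) ^ (3 / 2 : ℝ))⁻¹ • cross (t k) (x j τ' - datumLine Γ p t s₀ k σ)))
              R' τ →
            Rb * Real.sqrt (Γ * Real.log Γ) * ‖R' - ⟪R', deriv (x j) τ⟫_ℝ • deriv (x j) τ‖ ≤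
              Ch * (Real.sqrt Γ + |τ|) / Real.sqrt (Real.log Γ)) :
    LiaDefectDerivBL := by
  intro N δd ρd Λd Rwd θd mw p t γ α s₀ hN hδ hρ hRw hθ hmw hSD hGP
  -- the residual bound (RATE B) and the hypothesis
  obtain ⟨RbR, hRbR0, hres⟩ := liaResidual_bound N δd ρd Λd Rwd θd mw p t γ α s₀ hN hδ hρ hRw hθ hmw hSD hGP
  obtain ⟨RbH, hRbH0, hhyp⟩ := h N δd ρd Λd Rwd θd mw p t γ α s₀ hN hδ hρ hRw hθ hmw hSD hGP
  obtain ⟨ht, hsep, -, hparams, hq, -⟩ := hSD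
  -- general position with θg = min θd 1 ∈ (0, 1]
  set θg := min θd 1 with hθg
  have hθg0 : 0 < θg := lt_min hθ one_pos
  have hθg1 : θg ≤ 1 := min_le_right _ _
  have hGP' : ∀ j k, j ≠ k → |inner ℝ (t j) (t k)| ≤ 1 - θg := fun j k hjk =>
    (hGP j k hjk).trans (by linarith [min_le_left θd 1])
  have hγlo : ∀ k, θd ≤ |γ k| := fun k => (hparams.2.2 k).1
  have hγhi : ∀ k, |γ k| ≤ θd⁻¹ := fun k => (hparams.2.2 k).2
  have hα : |α| ≤ θd⁻¹ := hparams.2.1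
  obtain ⟨Cφ, hCφ0, hCφ⟩ := abs_deriv_smoothTransition_le
  obtain ⟨θ₁, hθ₁0, hθ₁h, hθ₁A⟩ := tiltBudget_exists θg ρd (fun j => p j + s₀ j • t j) hθg0 hρ
  -- the curvature constant
  set K : ℝ := 8 * Real.pi * RbR * (N / (Real.pi * θd * ρd) + (1 / 2 + θd⁻¹) * Rwd) / θd + 24 * Real.pi * (1 / 2 + θd⁻¹) * RbR ^ 2 / θd
    with hK
  have hK0 : 0 ≤ K := by positivity
  set Rb₁ : ℝ := min RbR (min RbH (min (4 * θ₁) (4 / 5))) with hRb₁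
  have hRb₁0 : 0 < Rb₁ := lt_min hRbR0 (lt_min hRbH0 (lt_min (by positivity) (by norm_num)))
  refine ⟨Rb₁, hRb₁0, fun Rb hRb hRbR1 => ?_⟩
  have hRbRle : Rb ≤ RbR := hRbR1.trans (min_le_left _ _)
  have hRbHle : Rb ≤ RbH := hRbR1.trans ((min_le_right _ _).trans (min_le_left _ _))
  have hRbθ : Rb / 8 ≤ θ₁ := by
    have : Rb ≤ 4 * θ₁ := hRbR1.trans ((min_le_right _ _).trans ((min_le_right _ _).trans (min_le_left _ _))); linarith
  have hRb45 : Rb ≤ 4 / 5 := hRbR1.trans ((min_le_right _ _).trans ((min_le_right _ _).trans (min_le_right _ _)))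
  obtain ⟨ΓR, CdR, hresΓ⟩ := hres Rb hRb hRbRle
  obtain ⟨ΓH, Ch, hhypΓ⟩ := hhyp Rb hRb hRbHle
  -- Γ threshold: log Γ ≥ max 1 (12 Rwd/Rb)²
  set Mx : ℝ := max ((12 * Rwd / Rb) ^ 2) 1 with hMx
  set Cd : ℝ := (2 * Real.sqrt 2 * Cφ + 2 * K) * max CdR 0 + max Ch 0 with hCd
  have hCd0 : 0 ≤ Cd := by positivity
  refine ⟨max (Real.exp Mx) (max ΓR ΓH), Cd, fun Γ hΓ x M hx hSF j τ hlow hup => ?_⟩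
  -- Γ-level facts
  have hΓe : Real.exp Mx ≤ Γ := (le_max_left _ _).trans hΓ
  have hΓR : ΓR ≤ Γ := ((le_max_left _ _).trans (le_max_right _ _)).trans hΓ
  have hΓH : ΓH ≤ Γ := ((le_max_right _ _).trans (le_max_right _ _)).trans hΓ
  have hΓe1 : Real.exp 1 ≤ Γ := (Real.exp_le_exp.2 (le_max_right _ _)).trans hΓe
  have hΓ1 : 1 < Γ := lt_of_lt_of_le (by have := Real.add_one_lt_exp (one_ne_zero (α := ℝ)); linarith) hΓe1
  have hΓ0 : 0 < Γ := by linarith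
  have hlog : Mx ≤ Real.log Γ := (Real.le_log_iff_exp_le hΓ0).2 hΓe
  have hlog1 : 1 ≤ Real.log Γ := (le_max_right _ _).trans hlog
  have hlog0 : 0 < Real.log Γ := by linarith
  have hsL : 12 * Rwd / Rb ≤ Real.sqrt (Real.log Γ) := by
    have h1 : (12 * Rwd / Rb) ^ 2 ≤ Real.log Γ := (le_max_left _ _).trans hlog
    have := Real.sqrt_le_sqrt h1
    rwa [Real.sqrt_sq (by positivity)] at this
  set ℓ := Rb * Real.sqrt (Γ * Real.log Γ) with hℓdef
  have hℓ0 : 0 < ℓ := by have : 0 < Real.sqrt (Γ * Real.log Γ) := Real.sqrt_pos.2 (by positivity); positivity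
  have hℓ : ℓ ≠ 0 := hℓ0.ne'
  have hrf0 : 0 ≤ (Real.sqrt Γ + |τ|) / Real.sqrt (Real.log Γ) := by positivity
  have hSM := hSF.2
  have htilt := hSF.1.2.1
  have hρΓ : 0 ≤ ρd * Real.sqrt Γ := by positivity
  have hC2 : ∀ k, ContDiff ℝ 2 (x k) := fun k => (hx k).1
  have hunit : ∀ k σ, ‖deriv (x k) σ‖ = 1 := fun k σ => (hx k).2.1 σ
  have hβ : liaCoeff Γ γ j ≠ 0 := by
    unfold liaCoeff
    have hγj : γ j ≠ 0 := fun h0 => by have := hγlo j; rw [h0, abs_zero] at this; linarith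
    exact div_ne_zero (mul_ne_zero (mul_ne_zero hΓ0.ne' hγj) hlog0.ne') (by positivity)
  -- linear escape of the reference (tilt ≤ Rb/8 ≤ 1/2)
  set C0 : ℝ := ∑ k, ‖x k 0‖ with hC0
  have hC0k : ∀ k, ‖x k 0‖ ≤ C0 := fun k =>
    Finset.single_le_sum (f := fun k => ‖x k 0‖) (fun k _ => norm_nonneg _) (Finset.mem_univ k)
  have hxg : ∀ k σ, (1/2:ℝ) * |σ| - C0 ≤ ‖x k σ‖ := fun k σ =>
    le_trans (by linarith [hC0k k]) (hx.norm_ge_half_abs_sub ht htilt (by linarith) k σ)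
  -- the EDGE: D′ = 0
  rcases hup.eq_or_lt with hedge | hint
  · refine ⟨0, swDefect_hasDerivAt_zero_of_le_sq (Γ := Γ) (γ := γ) (α := α) hSM hρΓ (by norm_num : (0:ℝ) < 1/2) hC2 hunit hxg hℓ j τ
      hedge.symm.le, ?_⟩
    rw [norm_zero, mul_zero]; positivity
  -- the INTERIOR: residual form
  have hτ : |τ| ≤ 3 * Rb * Real.sqrt Γ * Real.sqrt (Real.log Γ) := abs_param_le_of_sq_le_two hx hΓ1 hRb hRb45 j (htilt j) (hq j) hsL hup
  set Rfun : ℝ → EuclideanSpace ℝ (Fin 3) := fun τ' => ((Γ * γ j / (4 * Real.pi)) • (∫ σ : ℝ, ((‖x j τ' - x j σ‖ ^ 2 +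
          Real.exp (-(1+Real.eulerMascheroniConstant-Real.log 2)) * (1:ℝ)) ^ (3 / 2 : ℝ))⁻¹ • cross (deriv (x j) σ) (x j τ' - x j σ)) -
        liaCoeff Γ γ j • cross (deriv (x j) τ') (deriv (deriv (x j)) τ')) +
        ∑ k ∈ Finset.univ.erase j, (Γ * γ k / (4 * Real.pi)) • ((∫ σ : ℝ, ((‖x j τ' - x k σ‖ ^ 2 +
          Real.exp (-(1+Real.eulerMascheroniConstant-Real.log 2)) * (1:ℝ)) ^ (3 / 2 : ℝ))⁻¹ • cross (deriv (x k) σ) (x j τ' - x k σ)) -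
        ∫ σ : ℝ, ((‖x j τ' - datumLine Γ p t s₀ k σ‖ ^ 2 +
          Real.exp (-(1+Real.eulerMascheroniConstant-Real.log 2)) * (1:ℝ)) ^ (3 / 2 : ℝ))⁻¹ • cross (t k) (x j τ' - datumLine Γ p t s₀ k σ))
    with hRfun
  have hR : HasDerivAt Rfun _ τ := hx.hasDerivAt_residual ht (by norm_num : (0:ℝ) < 1/2) hxg hℓ j τ hup
  obtain ⟨R', hR'⟩ : ∃ R', HasDerivAt Rfun R' τ := ⟨_, hR⟩
  clear hR
  have hD := hx.swDefect_hasDerivAt_residualForm hSM hρΓ hℓ j hβ τ hint (R := Rfun) (fun τ' => by rw [hRfun]) hR'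
  refine ⟨_, hD, ?_⟩
  -- abbreviations
  set P := deriv (x j) τ with hPdef
  set P' := deriv (deriv (x j)) τ with hP'def
  set rf : ℝ := (Real.sqrt Γ + |τ|) / Real.sqrt (Real.log Γ) with hrf
  have hP1 : ‖P‖ = 1 := hunit j τ
  have hσ₀0 : 0 ≤ switchWeight ℓ 1 (x j τ) := switchWeight_nonneg _ _ _
  have hσ₀1 : switchWeight ℓ 1 (x j τ) ≤ 1 := switchWeight_le_one _ _ _
  -- (1) the hypothesis: ℓ‖P⊥R′‖ ≤ Ch·rf
  have h1 : ℓ * ‖R' - ⟪R', P⟫_ℝ • P‖ ≤ max Ch 0 * rf := by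
    have h := hhypΓ Γ hΓH x M hx hSF j τ hlow hint R' hR'
    have h' : ℓ * ‖R' - ⟪R', P⟫_ℝ • P‖ ≤ Ch * rf := by rw [hrf, ← mul_div_assoc]; exact h
    exact h'.trans (mul_le_mul_of_nonneg_right (le_max_left _ _) hrf0)
  -- (2) the residual bound: ‖R‖ ≤ CdR·rf
  have h2 : ‖Rfun τ‖ ≤ max CdR 0 * rf := by
    have h := hresΓ Γ hΓR x M hx hSF j τ hup
    have h' : ‖Rfun τ‖ ≤ CdR * rf := by
      rw [hrf, ← mul_div_assoc]
      refine le_trans ?_ h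
      simp only [hRfun]
      exact (norm_add_le _ _).trans (add_le_add le_rfl (norm_sum_le _ _))
    exact h'.trans (mul_le_mul_of_nonneg_right (le_max_left _ _) hrf0)
  -- (3) the switch-derivative term
  have h3 := norm_switchDeriv_smul_perp_mul_le (a := 1 - (‖x j τ‖ ^ 2 / ℓ ^ 2 + 1 - 2 * (1:ℝ))) (R := Rfun τ) hCφ hCφ0 hℓ0 hup hP1
  -- (4) the collar curvature: ℓ‖P′‖ ≤ K
  have h4 : ℓ * ‖P'‖ ≤ K := by
    have h := collar_curvature_mul_le N hθ hρ hRw.le hRb hΓ1 hlog1 hx ht hθg0 hθg1 hGP' hsep j hθ₁0.le (fun k _ => hθ₁A j k)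
      (fun σ => (htilt j σ).trans hRbθ) (hγlo j) hγhi hα hq hτ
    refine h.trans ?_
    rw [hK]
    have hQ0 : 0 ≤ N / (Real.pi * θd * ρd) + (1 / 2 + θd⁻¹) * Rwd := by positivity
    have hQ1 : 0 ≤ 24 * Real.pi * (1 / 2 + θd⁻¹) := by positivity
    have hsq : Rb ^ 2 ≤ RbR ^ 2 := pow_le_pow_left₀ hRb.le hRbRle 2
    have e1 : 8 * Real.pi * Rb * (N / (Real.pi * θd * ρd) + (1 / 2 + θd⁻¹) * Rwd) / θd ≤
        8 * Real.pi * RbR * (N / (Real.pi * θd * ρd) + (1 / 2 + θd⁻¹) * Rwd) / θd := by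
      gcongr
    have e2 : 24 * Real.pi * (1 / 2 + θd⁻¹) * Rb ^ 2 / θd ≤ 24 * Real.pi * (1 / 2 + θd⁻¹) * RbR ^ 2 / θd := by
      gcongr
    linarith
  -- assembly
  have hR0 : 0 ≤ ‖Rfun τ‖ := norm_nonneg _
  have h5 : 2 * Real.sqrt 2 * Cφ * ‖Rfun τ‖ ≤ 2 * Real.sqrt 2 * Cφ * (max CdR 0 * rf) := mul_le_mul_of_nonneg_left h2 (by positivity)
  have h6 : ‖Rfun τ‖ * (ℓ * ‖P'‖) ≤ (max CdR 0 * rf) * K := mul_le_mul h2 h4 (by positivity) (by positivity)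
  calc ℓ * ‖_‖ ≤ ℓ * (‖(deriv Real.smoothTransition (1 - (‖x j τ‖ ^ 2 / ℓ ^ 2 + 1 - 2 * (1:ℝ))) * (-(2 * ⟪x j τ, P⟫_ℝ / ℓ ^ 2))) •
        (Rfun τ - ⟪Rfun τ, P⟫_ℝ • P)‖ + ‖R' - ⟪R', P⟫_ℝ • P‖ + 2 * (‖Rfun τ‖ * ‖P'‖)) :=
        mul_le_mul_of_nonneg_left (norm_residualForm_le hP1 hσ₀0 hσ₀1) hℓ0.le
    _ = ℓ * ‖(deriv Real.smoothTransition (1 - (‖x j τ‖ ^ 2 / ℓ ^ 2 + 1 - 2 * (1:ℝ))) * (-(2 * ⟪x j τ, P⟫_ℝ / ℓ ^ 2))) •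
        (Rfun τ - ⟪Rfun τ, P⟫_ℝ • P)‖ + ℓ * ‖R' - ⟪R', P⟫_ℝ • P‖ + 2 * (‖Rfun τ‖ * (ℓ * ‖P'‖)) := by ring
    _ ≤ 2 * Real.sqrt 2 * Cφ * ‖Rfun τ‖ + max Ch 0 * rf + 2 * ((max CdR 0 * rf) * K) := add_le_add (add_le_add h3 h1) (by linarith)
    _ ≤ 2 * Real.sqrt 2 * Cφ * (max CdR 0 * rf) + max Ch 0 * rf + 2 * ((max CdR 0 * rf) * K) := by linarith
    _ = Cd * (Real.sqrt Γ + |τ|) / Real.sqrt (Real.log Γ) := by rw [hCd, hrf]; ring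

end Summit.NavierStokesRegularity.NavierStokesRegularity.Theorems.SkeletonJ1RFrame

end
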